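import Mathlib.Analysis.Calculus.InverseFunctionTheorem.ContDiff
import Literature.Topology.FourManifolds.PlanarArch
import Literature.Topology.FourManifolds.BandEdgeLift
import HarnessLib

/-!
# Inverses and monotone extensions of increasing functions on an interval

Topic `Literature/Topology/FourManifolds` (trunk T-4MAN). One-variable toolkit for the tame normal
form of band-sum presentations (decomposition of `Literature.Topology.FourManifolds.Knot.Schubert1949_normalPosition`):
the edge lifts `Θ` of `BandEdgeLift.lean` (angle of a summand as a function of the height along
an edge of the band) have to be inverted (height as a function of the angle) and extended to all
of `ℝ` as smooth monotone functions. Everything here is proved: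

* `Literature.Topology.FourManifolds.contDiffAt_of_eventually_leftInverse` — a *local* left inverse `g` of a `Cⁿ` function
  `f : ℝ → ℝ` with `f' a ≠ 0` (`g (f x) = x` only for `x` near `a`) is `Cⁿ` at `f a`; the
  local-hypothesis form of `contDiffAt_leftInverse_of_hasDerivAt` (`RadialDiffeomorph.lean`,
  global `LeftInverse`), needed because the lifts are only defined on an interval;
* `Literature.Topology.FourManifolds.MonoInverse` — for `Θ` continuous and strictly increasing on `[u₀, u₁]`, `C^∞` with
  positive derivative inside: the inverse `invFunOn Θ [u₀, u₁]` maps `[Θ u₀, Θ u₁]` back, inverts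
  `Θ` on both sides, is strictly increasing there, and is `C^∞` with positive derivative at the
  interior image points (`contDiffAt_of_eventually_leftInverse`);
* `Literature.Topology.FourManifolds.AntiInverse` — the same for strictly decreasing `Θ` (inverse decreasing);
* `Literature.Topology.FourManifolds.exists_increasing_extension_left` — a function `C^∞` with positive derivative on an open
  interval `(v₀, v₃)` is extended, unchanged on a compact `[v₁, v₂]`, to a globally `C^∞`
  function with positive derivative on `(-∞, v₂]`, affine of slope `1` far to the left (so that
  it attains every level below its values) — clamp (`exists_contDiff_clamp`) and blend
  (`exists_blend_deriv_pos`); and the three companion versions (decreasing / to the right).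

## References

Standard one-variable analysis; all statements `[folklore]`.
-/

open scoped ContDiff Topology
open Function Set

noncomputable section

namespace Literature.Topology.FourManifolds

/-! ### One-variable left inverses (local form) -/

/-- **Local left inverses are smooth.** If `f : ℝ → ℝ` is `Cⁿ` at `a` (`n ≥ 1`) with nonzero
derivative there and `g (f x) = x` for `x` near `a`, then `g` is `Cⁿ` at `f a` (it agrees near
`f a` with the local inverse of the inverse function theorem). This generalises
`contDiffAt_leftInverse_of_hasDerivAt` of `RadialDiffeomorph.lean` (which assumes the global
`LeftInverse g f`) to the eventual hypothesis needed for functions inverted on an interval only.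
[folklore] -/
theorem contDiffAt_of_eventually_leftInverse {f g : ℝ → ℝ} {f' a : ℝ} {n : WithTop ℕ∞}
    (hf : ContDiffAt ℝ n f a) (hf' : HasDerivAt f f' a) (h0 : f' ≠ 0) (hn : n ≠ 0)
    (hg : ∀ᶠ x in 𝓝 a, g (f x) = x) : ContDiffAt ℝ n g (f a) := by
  set Φ := hf.toOpenPartialHomeomorph f (hf'.hasFDerivAt_equiv h0) hn with hΦ
  have ha : a ∈ Φ.source := hf.mem_toOpenPartialHomeomorph_source (hf'.hasFDerivAt_equiv h0) hn
  have hfa : f a ∈ Φ.target := hf.image_mem_toOpenPartialHomeomorph_target (hf'.hasFDerivAt_equiv h0) hn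
  have hΦf : ∀ x, Φ x = f x := fun x ↦ rfl
  -- `Φ.symm y → a` as `y → f a`, so `g (f (Φ.symm y)) = Φ.symm y` eventually
  have hsymm : ContinuousAt Φ.symm (f a) := Φ.continuousAt_symm hfa
  have hsa : Φ.symm (f a) = a := by
    have := Φ.left_inv ha
    rwa [hΦf] at this
  have hev : g =ᶠ[𝓝 (f a)] Φ.symm := by
    have h1 : ∀ᶠ y in 𝓝 (f a), g (f (Φ.symm y)) = Φ.symm y := by
      have : Filter.Tendsto Φ.symm (𝓝 (f a)) (𝓝 a) := by
        have := hsymm.tendsto; rwa [hsa] at this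
      exact this.eventually hg
    filter_upwards [h1, Φ.open_target.mem_nhds hfa] with y hy hy'
    have h2 : f (Φ.symm y) = y := by rw [← hΦf]; exact Φ.right_inv hy'
    rw [← hy, h2]
  exact (hf.to_localInverse (hf'.hasFDerivAt_equiv h0) hn).congr_of_eventuallyEq hev

/-! ### Inverting a strictly monotone function on a compact interval -/

section Inverse

variable {Θ : ℝ → ℝ} {u₀ u₁ : ℝ}

/-- **The inverse of an increasing function on `[u₀, u₁]`**: basic algebra. If `Θ` is
continuous and strictly increasing on `[u₀, u₁]` (`u₀ < u₁`) then `Y = invFunOn Θ [u₀, u₁]`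
satisfies `Y (Θ u) = u` on `[u₀, u₁]`, and `Θ (Y s) = s`, `Y s ∈ [u₀, u₁]` on `[Θ u₀, Θ u₁]`;
`Y` is strictly increasing on `[Θ u₀, Θ u₁]`. [folklore] -/
theorem MonoInverse (hu : u₀ < u₁) (hc : ContinuousOn Θ (Icc u₀ u₁))
    (hm : StrictMonoOn Θ (Icc u₀ u₁)) :
    (∀ u ∈ Icc u₀ u₁, invFunOn Θ (Icc u₀ u₁) (Θ u) = u) ∧
    (∀ s ∈ Icc (Θ u₀) (Θ u₁), Θ (invFunOn Θ (Icc u₀ u₁) s) = s ∧ invFunOn Θ (Icc u₀ u₁) s ∈ Icc u₀ u₁) ∧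
    StrictMonoOn (invFunOn Θ (Icc u₀ u₁)) (Icc (Θ u₀) (Θ u₁)) := by
  have hsurj : SurjOn Θ (Icc u₀ u₁) (Icc (Θ u₀) (Θ u₁)) := hc.surjOn_Icc (left_mem_Icc.2 hu.le)
    (right_mem_Icc.2 hu.le)
  have h1 : ∀ u ∈ Icc u₀ u₁, invFunOn Θ (Icc u₀ u₁) (Θ u) = u := fun u hu' ↦
    hm.injOn.leftInvOn_invFunOn hu'
  have h2 : ∀ s ∈ Icc (Θ u₀) (Θ u₁), Θ (invFunOn Θ (Icc u₀ u₁) s) = s ∧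
      invFunOn Θ (Icc u₀ u₁) s ∈ Icc u₀ u₁ := fun s hs ↦
    ⟨invFunOn_eq (hsurj hs), invFunOn_mem (hsurj hs)⟩
  refine ⟨h1, h2, fun s hs s' hs' hss' ↦ ?_⟩
  by_contra hle
  push Not at hle
  have := hm.monotoneOn (h2 s' hs').2 (h2 s hs).2 hle
  rw [(h2 s hs).1, (h2 s' hs').1] at this
  exact absurd hss' (not_lt.2 this)

/-- **The inverse of an increasing function is smooth with positive derivative** at interior
image points, if `Θ` is `C^∞` with positive derivative inside. [folklore] -/
theorem MonoInverse_smooth (hu : u₀ < u₁) (hc : ContinuousOn Θ (Icc u₀ u₁))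
    (hm : StrictMonoOn Θ (Icc u₀ u₁)) (hs : ∀ u ∈ Ioo u₀ u₁, ContDiffAt ℝ ∞ Θ u)
    (hd : ∀ u ∈ Ioo u₀ u₁, 0 < deriv Θ u) :
    ∀ u ∈ Ioo u₀ u₁, ContDiffAt ℝ ∞ (invFunOn Θ (Icc u₀ u₁)) (Θ u) ∧
      deriv (invFunOn Θ (Icc u₀ u₁)) (Θ u) = (deriv Θ u)⁻¹ := by
  intro u hu'
  obtain ⟨h1, -, -⟩ := MonoInverse hu hc hm
  have hev : ∀ᶠ x in 𝓝 u, invFunOn Θ (Icc u₀ u₁) (Θ x) = x :=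
    Filter.eventually_of_mem (Icc_mem_nhds hu'.1 hu'.2) fun x hx ↦ h1 x hx
  have hΘd : HasDerivAt Θ (deriv Θ u) u := ((hs u hu').differentiableAt (by simp)).hasDerivAt
  have hsm : ContDiffAt ℝ ∞ (invFunOn Θ (Icc u₀ u₁)) (Θ u) :=
    contDiffAt_of_eventually_leftInverse (hs u hu') hΘd (hd u hu').ne' (by simp) hev
  refine ⟨hsm, ?_⟩
  -- chain rule on `Y ∘ Θ = id` near `u`
  have hY : HasDerivAt (invFunOn Θ (Icc u₀ u₁)) (deriv (invFunOn Θ (Icc u₀ u₁)) (Θ u)) (Θ u) :=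
    (hsm.differentiableAt (by simp)).hasDerivAt
  have hcomp : HasDerivAt (fun x ↦ invFunOn Θ (Icc u₀ u₁) (Θ x))
      (deriv (invFunOn Θ (Icc u₀ u₁)) (Θ u) * deriv Θ u) u := hY.comp u hΘd
  have hid : HasDerivAt (fun x ↦ invFunOn Θ (Icc u₀ u₁) (Θ x)) 1 u :=
    (hasDerivAt_id u).congr_of_eventuallyEq (hev.mono fun x hx ↦ by simp [hx])
  have := hcomp.unique hid
  field_simp [(hd u hu').ne'] at this ⊢
  linarith

/-- **The inverse of a decreasing function on `[u₀, u₁]`.** If `Θ` is continuous and strictly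
decreasing on `[u₀, u₁]` (`u₀ < u₁`) then `Y = invFunOn Θ [u₀, u₁]` inverts `Θ`:
`Y (Θ u) = u` on `[u₀, u₁]`, `Θ (Y s) = s` and `Y s ∈ [u₀, u₁]` on `[Θ u₁, Θ u₀]`, and `Y` is
strictly decreasing there. [folklore] -/
theorem AntiInverse (hu : u₀ < u₁) (hc : ContinuousOn Θ (Icc u₀ u₁))
    (hm : StrictAntiOn Θ (Icc u₀ u₁)) :
    (∀ u ∈ Icc u₀ u₁, invFunOn Θ (Icc u₀ u₁) (Θ u) = u) ∧
    (∀ s ∈ Icc (Θ u₁) (Θ u₀), Θ (invFunOn Θ (Icc u₀ u₁) s) = s ∧ invFunOn Θ (Icc u₀ u₁) s ∈ Icc u₀ u₁) ∧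
    StrictAntiOn (invFunOn Θ (Icc u₀ u₁)) (Icc (Θ u₁) (Θ u₀)) := by
  have hsurj : SurjOn Θ (Icc u₀ u₁) (Icc (Θ u₁) (Θ u₀)) := hc.surjOn_Icc (right_mem_Icc.2 hu.le)
    (left_mem_Icc.2 hu.le)
  have h1 : ∀ u ∈ Icc u₀ u₁, invFunOn Θ (Icc u₀ u₁) (Θ u) = u := fun u hu' ↦
    hm.injOn.leftInvOn_invFunOn hu'
  have h2 : ∀ s ∈ Icc (Θ u₁) (Θ u₀), Θ (invFunOn Θ (Icc u₀ u₁) s) = s ∧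
      invFunOn Θ (Icc u₀ u₁) s ∈ Icc u₀ u₁ := fun s hs ↦
    ⟨invFunOn_eq (hsurj hs), invFunOn_mem (hsurj hs)⟩
  refine ⟨h1, h2, fun s hs s' hs' hss' ↦ ?_⟩
  by_contra hle
  push Not at hle
  have := hm.antitoneOn (h2 s hs).2 (h2 s' hs').2 hle
  rw [(h2 s hs).1, (h2 s' hs').1] at this
  exact absurd hss' (not_lt.2 this)

/-- The inverse of a decreasing function is smooth with negative derivative at interior image
points. [folklore] -/
theorem AntiInverse_smooth (hu : u₀ < u₁) (hc : ContinuousOn Θ (Icc u₀ u₁))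
    (hm : StrictAntiOn Θ (Icc u₀ u₁)) (hs : ∀ u ∈ Ioo u₀ u₁, ContDiffAt ℝ ∞ Θ u)
    (hd : ∀ u ∈ Ioo u₀ u₁, deriv Θ u < 0) :
    ∀ u ∈ Ioo u₀ u₁, ContDiffAt ℝ ∞ (invFunOn Θ (Icc u₀ u₁)) (Θ u) ∧
      deriv (invFunOn Θ (Icc u₀ u₁)) (Θ u) = (deriv Θ u)⁻¹ := by
  intro u hu'
  obtain ⟨h1, -, -⟩ := AntiInverse hu hc hm
  have hev : ∀ᶠ x in 𝓝 u, invFunOn Θ (Icc u₀ u₁) (Θ x) = x :=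
    Filter.eventually_of_mem (Icc_mem_nhds hu'.1 hu'.2) fun x hx ↦ h1 x hx
  have hΘd : HasDerivAt Θ (deriv Θ u) u := ((hs u hu').differentiableAt (by simp)).hasDerivAt
  have hsm : ContDiffAt ℝ ∞ (invFunOn Θ (Icc u₀ u₁)) (Θ u) :=
    contDiffAt_of_eventually_leftInverse (hs u hu') hΘd (hd u hu').ne (by simp) hev
  refine ⟨hsm, ?_⟩
  have hY : HasDerivAt (invFunOn Θ (Icc u₀ u₁)) (deriv (invFunOn Θ (Icc u₀ u₁)) (Θ u)) (Θ u) :=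
    (hsm.differentiableAt (by simp)).hasDerivAt
  have hcomp : HasDerivAt (fun x ↦ invFunOn Θ (Icc u₀ u₁) (Θ x))
      (deriv (invFunOn Θ (Icc u₀ u₁)) (Θ u) * deriv Θ u) u := hY.comp u hΘd
  have hid : HasDerivAt (fun x ↦ invFunOn Θ (Icc u₀ u₁) (Θ x)) 1 u :=
    (hasDerivAt_id u).congr_of_eventuallyEq (hev.mono fun x hx ↦ by simp [hx])
  have := hcomp.unique hid
  field_simp [(hd u hu').ne] at this ⊢
  linarith

end Inverse

/-! ### Monotone extensions to the whole line -/

section Extension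

/-- The derivative of a smooth function which is the identity on `[v, w]` is `1` at every point
of `(v, w]` (compare with the identity from the left). [folklore] -/
theorem deriv_eq_one_of_eqOn_Icc {σ : ℝ → ℝ} {v w t : ℝ} (hσ : Differentiable ℝ σ)
    (hid : ∀ s ∈ Icc v w, σ s = s) (ht : t ∈ Ioc v w) : deriv σ t = 1 := by
  have h1 : HasDerivWithinAt σ (deriv σ t) (Iic t) t := (hσ t).hasDerivAt.hasDerivWithinAt
  have h2 : HasDerivWithinAt σ 1 (Iic t) t := by
    have hidt : σ t = t := hid t ⟨ht.1.le, ht.2⟩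
    refine ((hasDerivAt_id t).hasDerivWithinAt).congr_of_eventuallyEq ?_ hidt
    filter_upwards [Icc_mem_nhdsLE ht.1] with s hs
    exact hid s ⟨hs.1, hs.2.trans ht.2⟩
  rw [← h1.derivWithin (uniqueDiffWithinAt_Iic t), h2.derivWithin (uniqueDiffWithinAt_Iic t)]

/-- **Extending an increasing function to the left.** Let `y` be `C^∞` with positive derivative
at every point of the open interval `(v₀, v₃)`, and `v₀ < v₁ < v₂ < v₃`. Then there is a globally
`C^∞` function `f` with `f = y` on `[v₁, v₂]`, `f' > 0` on `(-∞, v₂]`, `f t = t + k` (affine of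
slope one) for `t ≤ v₀`, attaining on `(-∞, v₁)` every value below `y v₁`, and with all its
values on `[v₁, ∞)` of the form `y u`, `u ∈ (v₀, v₃)`. (Clamp `y` into `(v₀, v₃)` to make it
global, then blend it with an affine function lying below it.) [folklore] -/
theorem exists_increasing_extension_left {y : ℝ → ℝ} {v₀ v₁ v₂ v₃ : ℝ} (h₀₁ : v₀ < v₁)
    (h₁₂ : v₁ < v₂) (h₂₃ : v₂ < v₃) (hs : ∀ t ∈ Ioo v₀ v₃, ContDiffAt ℝ ∞ y t)
    (hd : ∀ t ∈ Ioo v₀ v₃, 0 < deriv y t) :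
    ∃ f : ℝ → ℝ, ContDiff ℝ ∞ f ∧ (∀ t ∈ Icc v₁ v₂, f t = y t) ∧ (∀ t, t ≤ v₂ → 0 < deriv f t) ∧
      (∃ k, ∀ t, t ≤ v₀ → f t = t + k) ∧ (∀ m, m < y v₁ → ∃ t, t < v₁ ∧ f t = m) ∧
      ∀ t, v₁ ≤ t → ∃ u ∈ Ioo v₀ v₃, f t = y u := by
  -- intermediate points `v₀ < v < v₁' < v₁`
  set v := (2 * v₀ + v₁) / 3 with hv
  set v₁' := (v₀ + 2 * v₁) / 3 with hv₁'
  have hv₀ : v₀ < v := by rw [hv]; linarith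
  have hvv₁' : v < v₁' := by rw [hv, hv₁']; linarith
  have hv₁'v₁ : v₁' < v₁ := by rw [hv₁']; linarith
  -- the clamp and the globalised `y`
  obtain ⟨σ, hσs, hσid, hσmem⟩ := exists_contDiff_clamp hv₀ (by linarith : v ≤ v₂) h₂₃
  set p₂ : ℝ → ℝ := fun t ↦ y (σ t) with hp₂
  have hp₂s : ContDiff ℝ ∞ p₂ := by
    rw [contDiff_iff_contDiffAt]
    intro t
    exact (hs _ (hσmem t)).comp t hσs.contDiffAt
  have hp₂eq : ∀ t ∈ Icc v v₂, p₂ t = y t := fun t ht ↦ by simp only [hp₂, hσid t ht]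
  have hp₂d : ∀ t ∈ Ioc v v₂, 0 < deriv p₂ t := by
    intro t ht
    have hσd : HasDerivAt σ 1 t := by
      rw [← deriv_eq_one_of_eqOn_Icc (hσs.differentiable (by simp)) hσid ht]
      exact ((hσs.differentiable (by simp)) t).hasDerivAt
    have hyd : HasDerivAt y (deriv y (σ t)) (σ t) :=
      ((hs _ (hσmem t)).differentiableAt (by simp)).hasDerivAt
    have h := (hyd.comp t hσd).deriv
    change deriv p₂ t = deriv y (σ t) * 1 at h
    rw [h, mul_one]
    exact hd _ (hσmem t)
  -- `y` is increasing on `[v, v₂]`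
  have hymono : MonotoneOn y (Icc v v₂) := by
    refine (strictMonoOn_of_deriv_pos (convex_Icc _ _) ?_ fun t ht ↦ ?_).monotoneOn
    · exact fun t ht ↦
        ((hs t ⟨by linarith [ht.1], by linarith [ht.2]⟩).continuousAt).continuousWithinAt
    · rw [interior_Icc] at ht; exact hd t ⟨by linarith [ht.1], by linarith [ht.2]⟩
  -- the affine function below `y` on `[v₁', v₁]`
  set k := y v₁' - 1 - v₁ with hk
  set p₁ : ℝ → ℝ := fun t ↦ t + k with hp₁
  have hp₁s : ContDiff ℝ ∞ p₁ := contDiff_id.add contDiff_const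
  have hp₁d : ∀ t, deriv p₁ t = 1 := fun t ↦ by
    simp only [hp₁]; rw [deriv_add_const, deriv_id'']
  have hle : ∀ t ∈ Icc v₁' v₁, p₁ t ≤ p₂ t := fun t ht ↦ by
    rw [hp₂eq t ⟨by linarith [ht.1], by linarith [ht.2]⟩]
    have : y v₁' ≤ y t :=
      hymono ⟨hvv₁'.le, by linarith⟩ ⟨by linarith [ht.1], by linarith [ht.2]⟩ ht.1
    simp only [hp₁, hk]; linarith [ht.2]
  obtain ⟨f, hfs, hfl, hfr, hfd, -⟩ := exists_blend_deriv_pos hv₁'v₁ hp₁s hp₂s hle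
    (fun t _ ↦ by rw [hp₁d]; exact one_pos) (fun t ht ↦ hp₂d t ⟨by linarith [ht.1], by linarith [ht.2]⟩)
  refine ⟨f, hfs, fun t ht ↦ ?_, fun t ht ↦ ?_, ⟨k, fun t ht ↦ hfl t (by linarith)⟩, fun m hm ↦ ?_,
    fun t ht ↦ ⟨σ t, hσmem t, hfr t ht⟩⟩
  · rw [hfr t ht.1, hp₂eq t ⟨by linarith [ht.1], ht.2⟩]
  · -- `f' > 0` on `(-∞, v₂]`
    rcases lt_or_ge t v₁' with h1 | h1
    · have : f =ᶠ[𝓝 t] p₁ := Filter.eventually_of_mem (Iio_mem_nhds h1) fun s hs ↦ hfl s hs.le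
      rw [this.deriv_eq, hp₁d]; exact one_pos
    rcases le_or_gt t v₁ with h2 | h2
    · exact hfd t ⟨h1, h2⟩
    · have : f =ᶠ[𝓝 t] p₂ := Filter.eventually_of_mem (Ioi_mem_nhds h2) fun s hs ↦ hfr s hs.le
      rw [this.deriv_eq]
      exact hp₂d t ⟨by linarith, ht⟩
  · -- every level below `y v₁` is attained left of `v₁`
    have hfc : Continuous f := hfs.continuous
    set t₀ := min v₀ (m - k - 1) with ht₀
    have ht₀v : t₀ ≤ v₀ := min_le_left _ _
    have hft₀ : f t₀ < m := by
      rw [hfl t₀ (by linarith)]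
      simp only [hp₁]
      have : t₀ ≤ m - k - 1 := min_le_right _ _
      linarith
    have hfv₁ : f v₁ = y v₁ := by rw [hfr v₁ le_rfl, hp₂eq v₁ ⟨by linarith, h₁₂.le⟩]
    obtain ⟨t, ht, hft⟩ : m ∈ f '' Icc t₀ v₁ :=
      intermediate_value_Icc (by linarith) hfc.continuousOn ⟨hft₀.le, by rw [hfv₁]; exact hm.le⟩
    refine ⟨t, lt_of_le_of_ne ht.2 ?_, hft⟩
    rintro rfl
    rw [hfv₁] at hft
    exact absurd hft hm.ne'

/-- **Extending a decreasing function to the left** (negate `exists_increasing_extension_left`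
applied to `-y`): `f = y` on `[v₁, v₂]`, `f' < 0` on `(-∞, v₂]`, `f t = -t + k` for `t ≤ v₀`,
`f` attains on `(-∞, v₁)` every value above `y v₁`, and its values on `[v₁, ∞)` are values of `y`
on `(v₀, v₃)`. [folklore] -/
theorem exists_decreasing_extension_left {y : ℝ → ℝ} {v₀ v₁ v₂ v₃ : ℝ} (h₀₁ : v₀ < v₁)
    (h₁₂ : v₁ < v₂) (h₂₃ : v₂ < v₃) (hs : ∀ t ∈ Ioo v₀ v₃, ContDiffAt ℝ ∞ y t)
    (hd : ∀ t ∈ Ioo v₀ v₃, deriv y t < 0) :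
    ∃ f : ℝ → ℝ, ContDiff ℝ ∞ f ∧ (∀ t ∈ Icc v₁ v₂, f t = y t) ∧ (∀ t, t ≤ v₂ → deriv f t < 0) ∧
      (∃ k, ∀ t, t ≤ v₀ → f t = -t + k) ∧ (∀ m, y v₁ < m → ∃ t, t < v₁ ∧ f t = m) ∧
      ∀ t, v₁ ≤ t → ∃ u ∈ Ioo v₀ v₃, f t = y u := by
  obtain ⟨F, hFs, hFeq, hFd, ⟨k, hk⟩, hlev, hval⟩ := exists_increasing_extension_left
    (y := fun t ↦ -y t) h₀₁ h₁₂ h₂₃ (fun t ht ↦ (hs t ht).neg)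
    (fun t ht ↦ by rw [deriv.fun_neg]; linarith [hd t ht])
  refine ⟨fun t ↦ -F t, hFs.neg, fun t ht ↦ by simp only [hFeq t ht, neg_neg], fun t ht ↦ ?_,
    ⟨-k, fun t ht ↦ by simp only [hk t ht]; ring⟩, fun m hm ↦ ?_, fun t ht ↦ ?_⟩
  · rw [deriv.fun_neg]; linarith [hFd t ht]
  · obtain ⟨t, ht, hFt⟩ := hlev (-m) (by linarith)
    exact ⟨t, ht, by simp only [hFt, neg_neg]⟩
  · obtain ⟨u, hu, hFu⟩ := hval t ht
    exact ⟨u, hu, by simp only [hFu, neg_neg]⟩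

/-- **Extending an increasing function to the right** (reflect the variable): `f = y` on
`[v₁, v₂]`, `f' > 0` on `[v₁, ∞)`, `f t = t + k` for `t ≥ v₃`, `f` attains on `(v₂, ∞)` every
value above `y v₂`, and its values on `(-∞, v₂]` are values of `y` on `(v₀, v₃)`. [folklore] -/
theorem exists_increasing_extension_right {y : ℝ → ℝ} {v₀ v₁ v₂ v₃ : ℝ} (h₀₁ : v₀ < v₁)
    (h₁₂ : v₁ < v₂) (h₂₃ : v₂ < v₃) (hs : ∀ t ∈ Ioo v₀ v₃, ContDiffAt ℝ ∞ y t)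
    (hd : ∀ t ∈ Ioo v₀ v₃, 0 < deriv y t) :
    ∃ f : ℝ → ℝ, ContDiff ℝ ∞ f ∧ (∀ t ∈ Icc v₁ v₂, f t = y t) ∧ (∀ t, v₁ ≤ t → 0 < deriv f t) ∧
      (∃ k, ∀ t, v₃ ≤ t → f t = t + k) ∧ (∀ m, y v₂ < m → ∃ t, v₂ < t ∧ f t = m) ∧
      ∀ t, t ≤ v₂ → ∃ u ∈ Ioo v₀ v₃, f t = y u := by
  -- `z t = -y (-t)` is increasing on `(-v₃, -v₀)`
  have hz : ∀ t ∈ Ioo (-v₃) (-v₀), ContDiffAt ℝ ∞ (fun t ↦ -y (-t)) t := fun t ht ↦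
    ((hs (-t) ⟨by linarith [ht.2], by linarith [ht.1]⟩).comp t contDiff_neg.contDiffAt).neg
  have hzd : ∀ t ∈ Ioo (-v₃) (-v₀), 0 < deriv (fun t ↦ -y (-t)) t := fun t ht ↦ by
    rw [deriv.fun_neg, deriv_comp_neg, neg_neg]
    exact hd (-t) ⟨by linarith [ht.2], by linarith [ht.1]⟩
  obtain ⟨F, hFs, hFeq, hFd, ⟨k, hk⟩, hlev, hval⟩ := exists_increasing_extension_left
    (y := fun t ↦ -y (-t)) (neg_lt_neg h₂₃) (neg_lt_neg h₁₂) (neg_lt_neg h₀₁) hz hzd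
  refine ⟨fun t ↦ -F (-t), (hFs.comp contDiff_neg).neg, fun t ht ↦ ?_, fun t ht ↦ ?_,
    ⟨-k, fun t ht ↦ ?_⟩, fun m hm ↦ ?_, fun t ht ↦ ?_⟩
  · simp only [hFeq (-t) ⟨by linarith [ht.2], by linarith [ht.1]⟩, neg_neg]
  · rw [deriv.fun_neg, deriv_comp_neg, neg_neg]
    exact hFd (-t) (by linarith)
  · simp only [hk (-t) (by linarith)]; ring
  · obtain ⟨t, ht, hFt⟩ := hlev (-m) (by simp only [neg_neg]; linarith)
    exact ⟨-t, by linarith, by simp only [neg_neg, hFt]⟩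
  · obtain ⟨u, hu, hFu⟩ := hval (-t) (by linarith)
    exact ⟨-u, ⟨by linarith [hu.2], by linarith [hu.1]⟩, by simp only [hFu, neg_neg]⟩

/-- **Extending a decreasing function to the right**: `f = y` on `[v₁, v₂]`, `f' < 0` on
`[v₁, ∞)`, `f t = -t + k` for `t ≥ v₃`, `f` attains on `(v₂, ∞)` every value below `y v₂`, and its
values on `(-∞, v₂]` are values of `y` on `(v₀, v₃)`. [folklore] -/
theorem exists_decreasing_extension_right {y : ℝ → ℝ} {v₀ v₁ v₂ v₃ : ℝ} (h₀₁ : v₀ < v₁)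
    (h₁₂ : v₁ < v₂) (h₂₃ : v₂ < v₃) (hs : ∀ t ∈ Ioo v₀ v₃, ContDiffAt ℝ ∞ y t)
    (hd : ∀ t ∈ Ioo v₀ v₃, deriv y t < 0) :
    ∃ f : ℝ → ℝ, ContDiff ℝ ∞ f ∧ (∀ t ∈ Icc v₁ v₂, f t = y t) ∧ (∀ t, v₁ ≤ t → deriv f t < 0) ∧
      (∃ k, ∀ t, v₃ ≤ t → f t = -t + k) ∧ (∀ m, m < y v₂ → ∃ t, v₂ < t ∧ f t = m) ∧
      ∀ t, t ≤ v₂ → ∃ u ∈ Ioo v₀ v₃, f t = y u := by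
  obtain ⟨F, hFs, hFeq, hFd, ⟨k, hk⟩, hlev, hval⟩ := exists_increasing_extension_right
    (y := fun t ↦ -y t) h₀₁ h₁₂ h₂₃ (fun t ht ↦ (hs t ht).neg)
    (fun t ht ↦ by rw [deriv.fun_neg]; linarith [hd t ht])
  refine ⟨fun t ↦ -F t, hFs.neg, fun t ht ↦ by simp only [hFeq t ht, neg_neg], fun t ht ↦ ?_,
    ⟨-k, fun t ht ↦ by simp only [hk t ht]; ring⟩, fun m hm ↦ ?_, fun t ht ↦ ?_⟩
  · rw [deriv.fun_neg]; linarith [hFd t ht]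
  · obtain ⟨t, ht, hFt⟩ := hlev (-m) (by linarith)
    exact ⟨t, ht, by simp only [hFt, neg_neg]⟩
  · obtain ⟨u, hu, hFu⟩ := hval t ht
    exact ⟨u, hu, by simp only [hFu, neg_neg]⟩

end Extension

end Literature.Topology.FourManifolds
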